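import Literature.AnabelianGeometry.SemiGraphs.TemperedPiDecomposition
import Literature.AnabelianGeometry.SemiGraphs.TemperedPiFibreMap
import Literature.AnabelianGeometry.SemiGraphs.TemperedPiActionLevel
import Literature.AnabelianGeometry.SemiGraphs.UniversalCoveringOverHomogeneous
import Literature.AnabelianGeometry.SemiGraphs.CoveringHomImage
import Literature.AnabelianGeometry.SemiGraphs.CoveringComponentSupport
import HarnessLib

/-!
# Compatible point sequences of the Galois tower trivialise the fibres ([SemiAnbd] Thm 3.7 (i)/(iii), pp. 40–41)

Mochizuki, *Semi-graphs of anabelioids*, Publ. RIMS **42** (2006) [MochizukiSemiAnbd2006], §3: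
Remark 2.2.1 p. 24 ("the images of `Π_v` … are the decomposition groups of the vertices"), the proof
of Prop. 3.6 (ii) p. 38 (`π₁^temp(𝒢) := lim_i Gal(𝒢_{∞,i}/𝒢)` acts on the fibres of tempered
coverings through the universal morphisms out of the `𝒢_{∞,i}`) and Thm. 3.7 (i)/(iii) pp. 40–41
("natural continuous injective outer homomorphism `π̂₁(𝒢_v) ↪ π₁^temp(𝒢)`"; compatible systems of
vertices of the trees `𝒢_{∞,i}`).

CHART HALF of the identifications (I1)–(I3) of `TemperedLevelData.lean` for the constructed tempered
fundamental group — generic part over seat abc-iut-L3-t9's `GaloisLevelData` (`cover n = 𝒢_{∞,S n}`,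
base points `bp n`, universal morphisms `liftAt`, action `piAct` on `T_{v₀}`) and seat
abc-iut-L3-t6's compatible point sequences `P : D.PointSeq h𝒢 v` (`TemperedPiDecomposition.lean`:
points `P.pt n ∈ (𝒢_{∞,S n})_v` with `stepCover (P.pt (n+1)) = P.pt n`, decomposition homomorphism
`P.decompHom : Π_v → π₁^temp` with `ρ_n(P.decompHom h) · P.pt n = h⁻¹ · P.pt n`).  For every
covering `T` whose components over `v₀` are split by the levels (e.g. a tempered covering under the
hypotheses of Prop. 3.6) we define the map `P.fibre T : T_{v₀} → T_v`, `s ↦ (liftAt_s)_v (P.pt n)`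
(the universal morphism `𝒢_{∞,S n} → T`, `bp n ↦ s`, evaluated at `P.pt n`) and prove: it is
independent of the level (`fibre_spec`: ANY morphism `𝒢_{∞,S n} → T` with `bp n ↦ s` computes it),
natural in `T` (`fibre_map`), injective (rigidity of `𝒢_{∞,S n}`), surjective for connected `𝔾`
(images of morphisms are unions of components; `Aut(𝒢_{∞,S n})` is transitive on fibres), and
intertwines the `π₁^temp`-action through `P.decompHom` on `T_{v₀}` with the `Π_v`-action on `T_v`
(`fibre_piAct`).  The sequel turns this into "`P.decompHom` is a verticial homomorphism for the
chart of Prop. 3.6 (ii)" — the chart half of (I2), and of (I1) through `exists_pointSeq_…`.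
Seat abc-iut-L3-t8 (row (β)-1). Nothing here bears on [IUTchIII] Cor. 3.12.
-/

namespace Literature.AnabelianGeometry.SemiGraphs

namespace ProfiniteSemiGraph

namespace GaloisLevelData

open CategoryTheory

universe u

variable {𝒢 : ProfiniteSemiGraph.{u}} (D : GaloisLevelData 𝒢) (h𝒢 : 𝒢.IsCountable)

/-! ### The covering maps of the tower and the universal morphisms -/

/-- The covering map `𝒢_{∞,S (n+1)} → 𝒢_{∞,S n}` of the tower maps `bp (n+1)` to `bp n`.
[cite: MochizukiSemiAnbd2006, Prop 3.6 p.38] -/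
theorem stepCover_bp (n : ℕ) :
    ((D.stepCover h𝒢 n).fV D.v₀).hom.hom (D.bp (n + 1)) = D.bp n := by
  have h2 := D.baseIso_projOver_bp h𝒢 n (D.x n) (D.hx n)
  exact h2

/-- **Level change for the universal morphisms**: `liftAt` at level `n+1` factors through the
covering map to level `n`. [cite: MochizukiSemiAnbd2006, Prop 3.6 p.38] -/
theorem liftAt_succ_eq_stepCover_comp (T : CovObj 𝒢) (s : (T.SV D.v₀).obj.V) (n : ℕ)
    (hs : (D.S n).Splits (T.component (Sum.inl ⟨D.v₀, s⟩)))
    (hs' : (D.S (n + 1)).Splits (T.component (Sum.inl ⟨D.v₀, s⟩))) :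
    D.liftAt h𝒢 T s (n + 1) hs' = D.stepCover h𝒢 n ≫ D.liftAt h𝒢 T s n hs := by
  apply D.hom_ext_bp h𝒢 (n + 1)
  rw [D.liftAt_bp]
  change _ = ((D.liftAt h𝒢 T s n hs).fV D.v₀).hom.hom
    (((D.stepCover h𝒢 n).fV D.v₀).hom.hom (D.bp (n + 1)))
  rw [D.stepCover_bp h𝒢 n, D.liftAt_bp]

/-- Any morphism `𝒢_{∞,S n} → T` sending `bp n` to `s` is `liftAt_s` followed by the inclusion of
the component of `s` (rigidity). [cite: MochizukiSemiAnbd2006, Prop 3.6 p.38] -/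
theorem eq_liftAt_comp_componentι (T : CovObj 𝒢) (s : (T.SV D.v₀).obj.V) (n : ℕ)
    (hs : (D.S n).Splits (T.component (Sum.inl ⟨D.v₀, s⟩))) (φ : D.cover h𝒢 n ⟶ T)
    (hφ : (φ.fV D.v₀).hom.hom (D.bp n) = s) :
    φ = D.liftAt h𝒢 T s n hs ≫ T.componentι (Sum.inl ⟨D.v₀, s⟩) := by
  apply D.hom_ext_bp h𝒢 n
  rw [hφ]
  change s = (((D.liftAt h𝒢 T s n hs).fV D.v₀).hom.hom (D.bp n)).1
  rw [D.liftAt_bp]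

/-- `liftAt_s ≫ ι` sends `bp n` to `s`. [cite: MochizukiSemiAnbd2006, Prop 3.6 p.38] -/
theorem liftAt_comp_componentι_bp (T : CovObj 𝒢) (s : (T.SV D.v₀).obj.V) (n : ℕ)
    (hs : (D.S n).Splits (T.component (Sum.inl ⟨D.v₀, s⟩))) :
    (((D.liftAt h𝒢 T s n hs ≫ T.componentι (Sum.inl ⟨D.v₀, s⟩))).fV D.v₀).hom.hom (D.bp n) = s := by
  change (((D.liftAt h𝒢 T s n hs).fV D.v₀).hom.hom (D.bp n)).1 = s
  rw [D.liftAt_bp]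

/-- Splitting by the levels propagates up the tower. [cite: MochizukiSemiAnbd2006, Prop 3.6 p.38] -/
private theorem splits_mono (X : CovObj 𝒢) {n m : ℕ} (hnm : n ≤ m) (hs : (D.S n).Splits X) :
    (D.S m).Splits X := by
  induction m, hnm using Nat.le_induction with
  | base => exact hs
  | succ k _ ih => exact CovObj.Splits.of_hom (D.g k) ih

namespace PointSeq

variable {D h𝒢} {v : 𝒢.graph.Vertex} (P : D.PointSeq h𝒢 v)

/-! ### The fibre map attached to a compatible point sequence -/

section Fibre

variable (T : CovObj 𝒢) (lev : (T.SV D.v₀).obj.V → ℕ)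
  (hlev : ∀ (s : (T.SV D.v₀).obj.V) (n : ℕ), lev s ≤ n →
    (D.S n).Splits (T.component (Sum.inl ⟨D.v₀, s⟩)))

/-- **The fibre map `T_{v₀} → T_v` of a compatible point sequence**: `s ↦ (liftAt_s)_v (P.pt n)` at
the level `n = lev s`. [cite: MochizukiSemiAnbd2006, Thm 3.7(i) p.40] -/
noncomputable def fibre (s : (T.SV D.v₀).obj.V) : (T.SV v).obj.V :=
  (((D.liftAt h𝒢 T s (lev s) (hlev s _ le_rfl)).fV v).hom.hom (P.pt (lev s))).1

/-- Level independence, raw form: the value `(liftAt_s at level m)_v (P.pt m)` does not depend on the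
level `m ≥ n` at which the component of `s` is split. [cite: MochizukiSemiAnbd2006, Prop 3.6 p.38] -/
theorem liftAt_apply_pt_eq (s : (T.SV D.v₀).obj.V) (n m : ℕ) (hnm : n ≤ m)
    (hsn : (D.S n).Splits (T.component (Sum.inl ⟨D.v₀, s⟩)))
    (hsm : (D.S m).Splits (T.component (Sum.inl ⟨D.v₀, s⟩))) :
    (((D.liftAt h𝒢 T s m hsm).fV v).hom.hom (P.pt m)).1 =
      (((D.liftAt h𝒢 T s n hsn).fV v).hom.hom (P.pt n)).1 := by
  induction m, hnm using Nat.le_induction with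
  | base => rfl
  | succ k hk ih =>
    have hsk : (D.S k).Splits (T.component (Sum.inl ⟨D.v₀, s⟩)) := D.splits_mono _ hk hsn
    rw [← ih hsk, D.liftAt_succ_eq_stepCover_comp h𝒢 T s k hsk hsm]
    change (((D.liftAt h𝒢 T s k hsk).fV v).hom.hom
      (((D.stepCover h𝒢 k).fV v).hom.hom (P.pt (k + 1)))).1 = _
    rw [P.compat k]

/-- **`P.fibre` is computed by any morphism `𝒢_{∞,S n} → T` sending `bp n` to `s`** (level
independence + rigidity). [cite: MochizukiSemiAnbd2006, Prop 3.6 p.38] -/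
theorem fibre_spec (s : (T.SV D.v₀).obj.V) (n : ℕ)
    (hsn : (D.S n).Splits (T.component (Sum.inl ⟨D.v₀, s⟩))) (φ : D.cover h𝒢 n ⟶ T)
    (hφ : (φ.fV D.v₀).hom.hom (D.bp n) = s) :
    P.fibre T lev hlev s = (φ.fV v).hom.hom (P.pt n) := by
  rw [D.eq_liftAt_comp_componentι h𝒢 T s n hsn φ hφ]
  change _ = (((D.liftAt h𝒢 T s n hsn).fV v).hom.hom (P.pt n)).1
  unfold fibre
  rcases le_total (lev s) n with h | h
  · exact (P.liftAt_apply_pt_eq T s (lev s) n h (hlev s _ le_rfl) hsn).symm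
  · exact P.liftAt_apply_pt_eq T s n (lev s) h hsn (hlev s _ le_rfl)

/-- **Naturality** of the fibre map in the covering `T`. [cite: MochizukiSemiAnbd2006, Prop 3.6(ii) p.38] -/
theorem fibre_map {T' : CovObj 𝒢} (f : T ⟶ T') (lev' : (T'.SV D.v₀).obj.V → ℕ)
    (hlev' : ∀ (s : (T'.SV D.v₀).obj.V) (n : ℕ), lev' s ≤ n →
      (D.S n).Splits (T'.component (Sum.inl ⟨D.v₀, s⟩))) (s : (T.SV D.v₀).obj.V) :
    P.fibre T' lev' hlev' ((f.fV D.v₀).hom.hom s) = (f.fV v).hom.hom (P.fibre T lev hlev s) := by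
  set n := max (lev s) (lev' ((f.fV D.v₀).hom.hom s)) with hn
  have hsn : (D.S n).Splits (T.component (Sum.inl ⟨D.v₀, s⟩)) := hlev s n (le_max_left _ _)
  have hsn' : (D.S n).Splits (T'.component (Sum.inl ⟨D.v₀, (f.fV D.v₀).hom.hom s⟩)) :=
    hlev' _ n (le_max_right _ _)
  have hφ : (((D.liftAt h𝒢 T s n hsn ≫ T.componentι (Sum.inl ⟨D.v₀, s⟩)) ≫ f).fV D.v₀).hom.hom
      (D.bp n) = (f.fV D.v₀).hom.hom s := by
    change (f.fV D.v₀).hom.hom (((D.liftAt h𝒢 T s n hsn).fV D.v₀).hom.hom (D.bp n)).1 = _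
    rw [D.liftAt_bp]
  rw [P.fibre_spec T' lev' hlev' _ n hsn' _ hφ,
    P.fibre_spec T lev hlev s n hsn _ (D.liftAt_comp_componentι_bp h𝒢 T s n hsn)]
  rfl

/-- **Injectivity** of the fibre map (rigidity of `𝒢_{∞,S n}`: morphisms agreeing at one point
agree). [cite: MochizukiSemiAnbd2006, Thm 3.7(i) p.40] -/
theorem fibre_injective : Function.Injective (P.fibre T lev hlev) := by
  intro s s' hss'
  set n := max (lev s) (lev s') with hn
  have hsn : (D.S n).Splits (T.component (Sum.inl ⟨D.v₀, s⟩)) := hlev s n (le_max_left _ _)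
  have hsn' : (D.S n).Splits (T.component (Sum.inl ⟨D.v₀, s'⟩)) := hlev s' n (le_max_right _ _)
  have h1 := D.liftAt_comp_componentι_bp h𝒢 T s n hsn
  have h1' := D.liftAt_comp_componentι_bp h𝒢 T s' n hsn'
  rw [P.fibre_spec T lev hlev s n hsn _ h1, P.fibre_spec T lev hlev s' n hsn' _ h1'] at hss'
  have heq := (D.S n).univCoverOver_hom_ext _ h𝒢 _ _ (P.pt n) hss'
  rw [← h1, ← h1', heq]

/-- **Surjectivity** of the fibre map for connected `𝔾`: every point of `T_v` lies in the component
of a point over `v₀`, that component is dominated by some `𝒢_{∞,S n}`, images of morphisms are unions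
of components, and `Aut(𝒢_{∞,S n})` is transitive on fibres. [cite: MochizukiSemiAnbd2006, Prop 3.6(ii) p.38] -/
theorem fibre_surjective (hc : 𝒢.graph.IsConnected) : Function.Surjective (P.fibre T lev hlev) := by
  intro y
  obtain ⟨s₀, hs₀⟩ := T.exists_mem_component_over hc y D.v₀
  set n := lev s₀ with hn
  have hsn : (D.S n).Splits (T.component (Sum.inl ⟨D.v₀, s₀⟩)) := hlev s₀ n le_rfl
  let φ : D.cover h𝒢 n ⟶ T := D.liftAt h𝒢 T s₀ n hsn ≫ T.componentι (Sum.inl ⟨D.v₀, s₀⟩)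
  have hφ : (φ.fV D.v₀).hom.hom (D.bp n) = s₀ := D.liftAt_comp_componentι_bp h𝒢 T s₀ n hsn
  have hcomp : T.SameComponent (Sum.inl ⟨D.v₀, (φ.fV D.v₀).hom.hom (D.bp n)⟩) (Sum.inl ⟨v, y⟩) := by
    rw [hφ]
    exact Relation.EqvGen.symm _ _ hs₀
  obtain ⟨x, hx⟩ := CovHom.exists_preimage_of_sameComponent φ (D.bp n) y hcomp
  obtain ⟨η, hη⟩ := (D.S n).exists_aut_apply_eq' h𝒢 (D.W n) (D.htrans n) (P.pt n) x
  -- the point hit by `η ≫ φ` at the base point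
  let s : (T.SV D.v₀).obj.V := ((η.hom ≫ φ).fV D.v₀).hom.hom (D.bp n)
  have hs : (D.S n).Splits (T.component (Sum.inl ⟨D.v₀, s⟩)) :=
    T.splits_component_of_sameComponent
      (((D.liftAt h𝒢 T s₀ n hsn).fV D.v₀).hom.hom ((η.hom.fV D.v₀).hom.hom (D.bp n))).2 hsn
  refine ⟨s, ?_⟩
  rw [P.fibre_spec T lev hlev s n hs (η.hom ≫ φ) rfl]
  change (φ.fV v).hom.hom ((η.hom.fV v).hom.hom (P.pt n)) = y
  rw [hη, hx]

/-- **Equivariance**: the fibre map intertwines the action of `Π_v` on `T_{v₀}` through the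
decomposition homomorphism `P.decompHom : Π_v → π₁^temp(𝒢)` with the action of `Π_v` on `T_v` ("the
images of `Π_v` are the decomposition groups", Rmk. 2.2.1). [cite: MochizukiSemiAnbd2006, Thm 3.7(i) p.40] -/
theorem fibre_piAct (h : 𝒢.Gv v) (s : (T.SV D.v₀).obj.V) :
    P.fibre T lev hlev (D.piAct h𝒢 T lev hlev (P.decompHom h) s) =
      (T.SV v).obj.ρ h (P.fibre T lev hlev s) := by
  set n := lev s with hn
  have hsn : (D.S n).Splits (T.component (Sum.inl ⟨D.v₀, s⟩)) := hlev s n le_rfl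
  set σ : D.Gal h𝒢 n := D.proj h𝒢 n (P.decompHom h) with hσ
  -- the acted point and a morphism computing it
  have hsplit : (D.S n).Splits (T.component (Sum.inl ⟨D.v₀, D.piAct h𝒢 T lev hlev (P.decompHom h) s⟩)) :=
    D.splits_actAt h𝒢 T s n hsn σ
  let φ : D.cover h𝒢 n ⟶ T :=
    (σ⁻¹ : D.Gal h𝒢 n).hom ≫ D.liftAt h𝒢 T s n hsn ≫ T.componentι (Sum.inl ⟨D.v₀, s⟩)
  have hφ : (φ.fV D.v₀).hom.hom (D.bp n) = D.piAct h𝒢 T lev hlev (P.decompHom h) s := rfl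
  rw [P.fibre_spec T lev hlev _ n hsplit φ hφ,
    P.fibre_spec T lev hlev s n hsn _ (D.liftAt_comp_componentι_bp h𝒢 T s n hsn)]
  -- `σ⁻¹ = ρ_n(decompHom h⁻¹)` moves `P.pt n` by `h`
  have hinv : (((σ⁻¹ : D.Gal h𝒢 n).hom.fV v).hom.hom) (P.pt n) =
      ((D.cover h𝒢 n).SV v).obj.ρ h (P.pt n) := by
    rw [hσ, ← map_inv, ← map_inv, P.proj_decompHom_apply n h⁻¹, inv_inv]
  change ((D.liftAt h𝒢 T s n hsn ≫ T.componentι (Sum.inl ⟨D.v₀, s⟩)).fV v).hom.hom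
      ((((σ⁻¹ : D.Gal h𝒢 n).hom.fV v).hom.hom) (P.pt n)) = _
  rw [hinv, CovHom.fV_ρ]

end Fibre

/-- The fibre map of `P` on `𝒢_{∞,S n}` itself sends `bp n` to `P.pt n`.
[cite: MochizukiSemiAnbd2006, Prop 3.6 p.38] -/
theorem fibre_bp (n : ℕ) (lev : ((D.cover h𝒢 n).SV D.v₀).obj.V → ℕ)
    (hlev : ∀ (s : ((D.cover h𝒢 n).SV D.v₀).obj.V) (m : ℕ), lev s ≤ m →
      (D.S m).Splits ((D.cover h𝒢 n).component (Sum.inl ⟨D.v₀, s⟩)))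
    (hn : (D.S n).Splits ((D.cover h𝒢 n).component (Sum.inl ⟨D.v₀, D.bp n⟩))) :
    P.fibre (D.cover h𝒢 n) lev hlev (D.bp n) = P.pt n :=
  P.fibre_spec _ lev hlev (D.bp n) n hn (𝟙 _) rfl

end PointSeq

end GaloisLevelData

end ProfiniteSemiGraph

end Literature.AnabelianGeometry.SemiGraphs
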